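import Literature.NumberTheory.LFunctions.KhalePrincipal
import Literature.NumberTheory.LFunctions.KhaleLemma63
import HarnessLib

/-!
# Khale 2024, Lemma 6.3 for the principal character `χ₀` modulo `q`

Topic `Literature/NumberTheory/LFunctions`.  Everything in this file is PROVED; no definition, no
named fact.  Companion of `KhaleL63.lemma63` (`χ ≠ χ₀`) for the principal character, from
`KhalePrincipal.lemma62_triv` (Lemma 6.2 for `χ₀`, pole term kept):

* `KhalePrincipal.lemma63_triv` — **Lemma 6.3 for `χ₀`** with the constant `3.777` that the printed
  argument yields (T. Khale, arXiv:2210.06457v1, Lemma 6.3; the printed `0.49` rests on Ford 2002,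
  Lemma 4.2's slip, see `KhaleLemma63.lean` and `VinogradovKorobovNearZeroCount.lean`):
  `N_{χ₀}(t, R)` is the tree's `fordN t R` (the zeros of `L(·, χ₀)` near `1 + it` are those of `ζ`);
  the pole term is `≤ 0.17/t² ≤ 10⁻¹²` and is absorbed in the rounding `3.7768… → 3.777`.

## References

* T. Khale, arXiv:2210.06457v1, Lemma 6.3 (`δ(χ) = 1`). [Khale2024]
* K. Ford, *Zero-free regions for the Riemann zeta function* (2002), Lemma 4.2. [Ford2002Millennium]
-/

noncomputable section

open Complex Set Metric Filter Topology MeasureTheory Real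
open Literature.Analysis.Complex Literature.Analysis.Complex.FordDetector

namespace Literature.NumberTheory.LFunctions

namespace KhalePrincipal

open FordL34 PrincipalDetector NearZeroCount

variable {q : ℕ} [NeZero q]

/-! ### Lemma 6.3 for `χ₀` -/

set_option maxHeartbeats 800000 in
/-- **Khale 2024, Lemma 6.3 for the principal character, with the constant `3.777` that the printed
argument yields** (`N_{χ₀}(t, R) = N(t, R)`, the tree's `fordN t R`: the zeros of `L(·, χ₀)` near
`1 + it` are those of `ζ`). Assume (2.4), `q ≥ 3`, `t ≥ e^{1938}`, `t ≥ q^{1/100000}`,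
`1.04(log(t/100))^{−2/3} ≤ R ≤ 1/4`. Then
`N(t, R) ≤ 1.3478 R^{3/2} B log t + 3.777 + (log(A+1) − log R + 1.8579 R log q + ⅔ log log t)/1.879`.
[cite: Khale2024, Lemma 6.3] -/
theorem lemma63_triv {A B : ℝ} (hA : 0 < A) (hB : 0 < B) (hF : HasHurwitzFordBound A B)
    (hq : 3 ≤ q) {t R : ℝ} (ht : Real.exp 1938 ≤ t) (htq : (q : ℝ) ^ (1 / 100000 : ℝ) ≤ t)
    (hRl : 1.04 * Real.log (t / 100) ^ (-(2 / 3 : ℝ)) ≤ R) (hR4 : R ≤ 1 / 4) :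
    fordN t R ≤ 1.3478 * R ^ (3 / 2 : ℝ) * B * Real.log t + 3.777
      + (Real.log (A + 1) - Real.log R + 1.8579 * R * Real.log q + 2 / 3 * Real.log (Real.log t)) / 1.879 := by
  classical
  have ht6 : (10 : ℝ) ^ 6 ≤ t := KhaleL52.exp_1938_ge.trans ht
  have h6 : (10 : ℝ) ^ 6 = 1000000 := by norm_num
  have ht0 : 0 < t := by linarith
  have hX : 0 < Real.log (t / 100) ^ (-(2 / 3 : ℝ)) :=
    Real.rpow_pos_of_pos (Real.log_pos (by rw [lt_div_iff₀ (by norm_num)]; linarith)) _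
  have hR : 0 < R := lt_of_lt_of_le (by positivity) hRl
  set σ : ℝ := 1 + 0.6421 * R with hσ
  set η : ℝ := 5 / 2 * R with hη
  have hη0 : 0 < η := by positivity
  -- the disc zeros qualify
  have hmem : ∀ ρ ∈ fordNearZeros t R, riemannZeta ρ = 0 ∧ σ - η ≤ ρ.re := by
    intro ρ hρ
    rw [mem_fordNearZeros] at hρ
    have hre := Complex.abs_re_le_norm (1 + t * I - ρ)
    simp only [Complex.sub_re, Complex.add_re, Complex.one_re, Complex.mul_re, Complex.ofReal_re,
      Complex.I_re, mul_zero, Complex.ofReal_im, Complex.I_im, mul_one, sub_self, add_zero] at hre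
    rw [abs_le] at hre
    refine ⟨hρ.1, ?_⟩
    rw [hσ, hη]; linarith [hre.1, hre.2, hρ.2]
  have h := lemma62_triv (q := q) hA hB hF hq (σ := σ) (t := t) (η := η) ht htq hη0
    (by rw [hη]; linarith) (by rw [hσ, hη]; linarith) (by rw [hσ]; linarith)
    (by rw [hσ, hη]; nlinarith) (by rw [hσ, hη]; linarith) (fordNearZeros t R) hmem
  -- (o) the pole term is `≤ 10⁻⁶ · 0.3758/R`-small: `(σ-1)/|s-1|² ≤ (σ-1)/t²`
  have hpole : (σ - 1) / ‖(σ : ℂ) + t * I - 1‖ ^ 2 ≤ 1 / 10 ^ 12 := by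
    have hnum : σ - 1 = 0.6421 * R := by rw [hσ]; ring
    have hden : t ^ 2 ≤ ‖(σ : ℂ) + t * I - 1‖ ^ 2 := by
      rw [show (σ : ℂ) + t * I - 1 = ((σ - 1 : ℝ) : ℂ) + ((t : ℝ) : ℂ) * I by push_cast; ring,
        Complex.sq_norm, Complex.normSq_add_mul_I]
      nlinarith
    rw [hnum, div_le_div_iff₀ (lt_of_lt_of_le (by positivity) hden) (by positivity)]
    calc 0.6421 * R * 10 ^ 12 ≤ 0.6421 * (1 / 4) * 10 ^ 12 := by nlinarith
      _ ≤ 1 * t ^ 2 := by nlinarith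
      _ ≤ 1 * ‖(σ : ℂ) + t * I - 1‖ ^ 2 := by linarith
  -- (i) the left side `≥ −1/(0.6421R)`
  have hlhs : -(1 / (0.6421 * R)) ≤ -(deriv (DirichletCharacter.LFunctionTrivChar q) (σ + t * I) /
      DirichletCharacter.LFunctionTrivChar q (σ + t * I)).re := by
    have hs : 1 < ((σ : ℂ) + t * I).re := by simp [hσ]; positivity
    have h1 := KhaleL41.norm_logDeriv_LFunction_lt (1 : DirichletCharacter ℂ q) (s := (σ : ℂ) + t * I) hs
    have e : ((σ : ℂ) + t * I).re - 1 = 0.6421 * R := by simp [hσ]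
    rw [e] at h1
    have h2 := Complex.re_le_norm (deriv (DirichletCharacter.LFunctionTrivChar q) (σ + t * I) /
      DirichletCharacter.LFunctionTrivChar q (σ + t * I))
    have h3 : ‖deriv (DirichletCharacter.LFunctionTrivChar q) (σ + t * I) /
        DirichletCharacter.LFunctionTrivChar q (σ + t * I)‖ < 1 / (0.6421 * R) := h1
    linarith
  -- (ii) the cot terms: `Re h_η(ρ − s) ≤ −0.3758/R` on the disc
  have hcotρ : ∀ ρ ∈ fordNearZeros t R, (fordCot η (ρ - (σ + t * I))).re ≤ -(0.3758 / R) := by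
    intro ρ hρ
    rw [mem_fordNearZeros] at hρ
    have hre1 : ρ.re < 1 := by
      by_contra hle
      exact riemannZeta_ne_zero_of_one_le_re (not_lt.1 hle) hρ.1
    set z : ℂ := ((σ : ℂ) + t * I - ρ) / (R : ℂ) with hz
    have hRC : (R : ℂ) ≠ 0 := by exact_mod_cast hR.ne'
    have ecoef : ((π / (2 * η) : ℝ) : ℂ) = ((1 / R : ℝ) : ℂ) * ((π / 5 : ℝ) : ℂ) := by
      rw [hη]; push_cast; field_simp
    have earg : ((π / (2 * η) : ℝ) : ℂ) * ((σ : ℂ) + t * I - ρ) = ((π / 5 : ℝ) : ℂ) * z := by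
      rw [ecoef, hz]; push_cast; field_simp
    have hzre : 0.6421 ≤ z.re := by
      rw [hz, Complex.div_ofReal_re]
      simp only [Complex.sub_re, Complex.add_re, Complex.ofReal_re, Complex.mul_re, Complex.I_re,
        mul_zero, Complex.ofReal_im, Complex.I_im, mul_one, sub_self, add_zero]
      rw [hσ, le_div_iff₀ hR]
      have hre := Complex.abs_re_le_norm (1 + t * I - ρ)
      simp only [Complex.sub_re, Complex.add_re, Complex.one_re, Complex.mul_re, Complex.ofReal_re,
        Complex.I_re, mul_zero, Complex.ofReal_im, Complex.I_im, mul_one, sub_self, add_zero] at hre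
      rw [abs_le] at hre
      nlinarith [hre.1, hre.2, hρ.2, hre1]
    have hznorm : ‖z - 0.6421‖ ≤ 1 := by
      have e : z - 0.6421 = (1 + t * I - ρ) / (R : ℂ) := by
        rw [hz, hσ]; push_cast; field_simp; ring
      rw [e, norm_div, Complex.norm_real, Real.norm_eq_abs, abs_of_pos hR, div_le_one hR]
      exact hρ.2
    have hc := ford_re_cot_ge z hzre hznorm
    have eneg : fordCot η (ρ - (σ + t * I)) = -fordCot η ((σ : ℂ) + t * I - ρ) := by
      rw [← fordCot_neg, neg_sub]
    have epos : (fordCot η ((σ : ℂ) + t * I - ρ)).re =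
        1 / R * (((π / 5 : ℝ) : ℂ) * Complex.cot (((π / 5 : ℝ) : ℂ) * z)).re := by
      simp only [fordCot]
      rw [earg, ecoef, mul_assoc, Complex.re_ofReal_mul]
    rw [eneg, Complex.neg_re, epos, neg_le_neg_iff, div_eq_mul_one_div, mul_comm]
    exact mul_le_mul_of_nonneg_left hc (by positivity)
  have hsum : ∑ ρ ∈ fordNearZeros t R, (riemannZetaZeroOrder ρ : ℝ) * (fordCot η (ρ - (σ + t * I))).re ≤
      -(0.3758 / R) * fordN t R := by
    unfold fordN
    rw [Finset.mul_sum]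
    refine Finset.sum_le_sum fun ρ hρ ↦ ?_
    have hm : (0 : ℝ) ≤ riemannZetaZeroOrder ρ := by
      have hz0 := (mem_fordNearZeros.1 hρ).1
      exact_mod_cast riemannZetaZeroOrder_nonneg fun h1 ↦ riemannZeta_one_ne_zero (h1 ▸ hz0)
    rw [mul_comm (-(0.3758 / R))]
    exact mul_le_mul_of_nonneg_left (hcotρ ρ hρ) hm
  -- (iii) the integral term
  have hση : σ + η = 1 + 3.1421 * R := by rw [hσ, hη]; ring
  have hint : -(1 / (4 * η) * ∫ u : ℝ, Real.log ‖DirichletCharacter.LFunctionTrivChar q ((σ + η : ℝ) +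
        ((t + u * (2 * η / π) : ℝ) : ℂ) * I)‖ / Real.cosh u ^ 2)
      ≤ 1 / (2 * η) * (-Real.log R - 0.6903) := by
    have h1 := KhaleL63.integral_log_norm_LFunction_ge (1 : DirichletCharacter ℂ q) (σ' := σ + η)
      (by rw [hση]; linarith) t (2 * η / π)
    rw [hση] at h1 ⊢
    have h2 := log_zeta_ramare_bound hR hR4
    have h4η : 0 < 1 / (4 * η) := by positivity
    have e : 1 / (2 * η) = 2 * (1 / (4 * η)) := by field_simp; ring
    rw [e]
    have h1' : -2 * Real.log (riemannZeta ((1 + 3.1421 * R : ℝ) : ℂ)).re ≤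
        ∫ u : ℝ, Real.log ‖DirichletCharacter.LFunctionTrivChar q (((1 + 3.1421 * R : ℝ) : ℂ) +
          ((t + u * (2 * η / π) : ℝ) : ℂ) * I)‖ / Real.cosh u ^ 2 := h1
    nlinarith
  -- (iv) the Richert term
  have hrich : 1 - σ + η = 1.8579 * R := by rw [hσ, hη]; ring
  have hpow : (1 - σ + η) ^ (3 / 2 : ℝ) ≤ 2.5325 * R ^ (3 / 2 : ℝ) := by
    rw [hrich, Real.mul_rpow (by norm_num) hR.le]
    refine mul_le_mul_of_nonneg_right ?_ (by positivity)
    have e : (1.8579 : ℝ) ^ (3 / 2 : ℝ) = 1.8579 * Real.sqrt 1.8579 := by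
      rw [show (3 / 2 : ℝ) = 1 + 1 / 2 by norm_num, Real.rpow_add (by norm_num), Real.rpow_one,
        Real.sqrt_eq_rpow]
    rw [e]
    have hs : Real.sqrt 1.8579 ≤ 1.36305 := by
      rw [Real.sqrt_le_left (by norm_num)]; norm_num
    nlinarith [Real.sqrt_nonneg 1.8579]
  -- assemble
  have hL : 0 ≤ Real.log t := Real.log_nonneg (by linarith)
  have hlogq : 0 ≤ Real.log (q : ℝ) := Real.log_natCast_nonneg q
  have h2η : 1 / (2 * η) = 1 / (5 * R) := by rw [hη]; ring
  have hkey : 0.3758 / R * fordN t R ≤ 1 / (0.6421 * R) + 1 / 10 ^ 12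
      + 1 / (5 * R) * (1.8579 * R * Real.log q + 2 / 3 * Real.log (Real.log t)
          + B * (2.5325 * R ^ (3 / 2 : ℝ)) * Real.log t + Real.log (A + 1))
      + 1 / (5 * R) * (-Real.log R - 0.6903) := by
    have hBt : B * (1 - σ + η) ^ (3 / 2 : ℝ) * Real.log t ≤ B * (2.5325 * R ^ (3 / 2 : ℝ)) * Real.log t :=
      mul_le_mul_of_nonneg_right (mul_le_mul_of_nonneg_left hpow hB.le) hL
    have h5R : 0 < 1 / (5 * R) := by positivity
    rw [h2η, hrich] at h
    rw [h2η] at hint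
    rw [hrich] at hBt
    nlinarith [h, hlhs, hsum, hint, hBt, h5R, hpole]
  -- divide by `0.3758/R`
  have hN0 := fordN_nonneg t R
  have hR32 : 0 ≤ R ^ (3 / 2 : ℝ) := by positivity
  have e : (1 / (0.6421 * R) + 1 / 10 ^ 12
      + 1 / (5 * R) * (1.8579 * R * Real.log q + 2 / 3 * Real.log (Real.log t)
          + B * (2.5325 * R ^ (3 / 2 : ℝ)) * Real.log t + Real.log (A + 1))
      + 1 / (5 * R) * (-Real.log R - 0.6903)) * (R / 0.3758)
      = (1 / 0.6421 - 0.6903 / 5) / 0.3758 + (1 / 10 ^ 12) * (R / 0.3758)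
        + (2.5325 / (5 * 0.3758)) * R ^ (3 / 2 : ℝ) * B * Real.log t
        + (Real.log (A + 1) - Real.log R + 1.8579 * R * Real.log q + 2 / 3 * Real.log (Real.log t))
            / (5 * 0.3758) := by
    field_simp; ring
  have hmul := mul_le_mul_of_nonneg_right hkey (show (0 : ℝ) ≤ R / 0.3758 by positivity)
  rw [e, show 0.3758 / R * fordN t R * (R / 0.3758) = fordN t R by field_simp] at hmul
  have hc1 : (1 / 0.6421 - 0.6903 / 5) / 0.3758 + (1 / 10 ^ 12) * (R / 0.3758) ≤ (3.777 : ℝ) := by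
    have : (1 / 10 ^ 12 : ℝ) * (R / 0.3758) ≤ 1 / 10 ^ 12 := by
      have : R / 0.3758 ≤ 1 := by rw [div_le_one (by norm_num)]; linarith
      nlinarith
    norm_num at this ⊢
    linarith
  have hc2 : 2.5325 / (5 * 0.3758) * R ^ (3 / 2 : ℝ) * B * Real.log t ≤
      1.3478 * R ^ (3 / 2 : ℝ) * B * Real.log t := by
    have : 0 ≤ R ^ (3 / 2 : ℝ) * B * Real.log t := by positivity
    have hc : (2.5325 / (5 * 0.3758) : ℝ) ≤ 1.3478 := by norm_num
    nlinarith
  have hc3 : (Real.log (A + 1) - Real.log R + 1.8579 * R * Real.log q + 2 / 3 * Real.log (Real.log t))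
      / (5 * 0.3758)
      = (Real.log (A + 1) - Real.log R + 1.8579 * R * Real.log q + 2 / 3 * Real.log (Real.log t)) / 1.879 := by
    norm_num
  linarith

end KhalePrincipal

end Literature.NumberTheory.LFunctions
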